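import Literature.Analysis.FluidPDE.BoussinesqSmallScaleFormation
import HarnessLib

/-!
# Global regularity of the 2-D Boussinesq system with PARTIAL viscosity (Chae 2006, Thms 1.1, 1.2)
# and the `∇θ` continuation criterion (Chae 2006 Thm 2.1 = Chae–Nam 1997 / E–Shu 1994) — named facts

D. Chae, *Global regularity for the 2D Boussinesq equations with partial viscosity terms*, Adv. Math.
**203** (2006) 497–513, doi:10.1016/j.aim.2005.05.001 (held text `paper:doi-10-1016-j-aim-2005-05-001`,
pp. 2–3 opened). System (B) on `ℝ² × (0, ∞)`: `vₜ + (v·∇)v = −∇p + νΔv + θe₂`,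
`θₜ + (v·∇)θ = κΔθ`, `div v = 0`, `ν ≥ 0` viscosity, `κ ≥ 0` thermal diffusivity, `e₂ = (0,1)`
[p0002]. (B1) = `κ = 0`, `ν > 0` fixed ("zero diffusivity"); (B2) = `ν = 0`, `κ > 0` ("zero viscosity").

> **Theorem 1.1** [p0003 L12]. Let `ν > 0` be fixed, and `div v₀ = 0`. Let `m > 2` be an integer,
> and `(v₀, θ₀) ∈ H^m(ℝ²)`. Then, there exists a unique solution `(v, θ)` with
> `θ ∈ C([0, ∞); H^m(ℝ²))` and `v ∈ C([0, ∞); H^m(ℝ²)) ∩ L²(0, T; H^{m+1}(ℝ²))` of the system (B1).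
> Moreover, for each `s < m`, the solutions `(v, θ)` of (B) converge to the corresponding solutions
> of (B1) in `C([0, T]; H^s(ℝ²))` as `κ → 0`.
>
> **Theorem 1.2** [p0003 L47]. Let `κ > 0` be fixed, and `div v₀ = 0`. Let `m > 2` be an integer, and
> `(v₀, θ₀) ∈ H^m(ℝ²)`. Then, there exists unique solutions `(v, θ)` with `v ∈ C([0, ∞); H^m(ℝ²))`
> and `θ ∈ C([0, ∞); H^m(ℝ²)) ∩ L²(0, T; H^{m+1}(ℝ²))` of the system (B2). [+ the `ν → 0` limit.]
>
> **Theorem 2.1** [p0003 L56] ("proved in [3,6]" = Chae–Nam, Proc. Roy. Soc. Edinburgh A 127 (1997)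
> 935–946; E–Shu, Phys. Fluids 6 (1994) 49–58; "see also [4]" = Chae–Kim–Nam 1999). Suppose
> `(v₀, θ₀) ∈ H^m(ℝ²)` with `m > 2` being an integer. Then, there exists a unique local classical
> solution `(v, θ) ∈ C([0, T₁); H^m(ℝ²))` for some `T₁ = T₁(‖v₀‖_{H^m}, ‖θ₀‖_{H^m})`. Moreover, the
> solution remains in `H^m(ℝ²)` up to time `T > T₁`, namely `(v, θ) ∈ C([0, T]; H^m(ℝ²))` if and
> only if `∫₀ᵀ ‖∇θ(t)‖_{L^∞} dt < ∞` (2.1). ["By obvious changes of the proof in [3] … a similar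
> conclusion holds for system (B1) and (B2)."]

The literature around it (Kiselev–Park–Yao, Anal. PDE 2025 = arXiv:2211.05070 §1.1, held p0003
L17–L20, quoted): "In the absence of thermal diffusion, the first global-in-time regularity results
were obtained by Hou–Li [DCDS 12 (2005) 1–12] in the space `(u,ρ) ∈ H^m(ℝ²) × H^{m−1}(ℝ²)` for
`m ≥ 3`, and Chae [this paper] in the space `H^m(ℝ²) × H^m(ℝ²)` for `m ≥ 3`. When `Ω ⊂ ℝ²` is a
bounded domain, Lai–Pan–Zhao [ARMA 199 (2011)] proved global well-posedness of solutions in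
`H³(Ω) × H³(Ω)` with no-slip boundary condition … improved by Hu–Kukavica–Ziane [Asymptot. Anal.
2013] to `H^m(Ω) × H^{m−1}(Ω)` for `m ≥ 2`, where `Ω` is either a bounded domain or `ℝ²`, `𝕋²`."
KPY then speak of "the global-in-time smooth solution `(ρ, u)`" for smooth data (their Thm 1.1,
`ν > 0`), which is the reading typed here.

## Contents

* `IsClassicalBoussinesqDiffusiveOnPlane S ν κ u p θ` — classical (jointly `C^∞`) solutions of (B)
  on `S × ℝ²` in velocity form, general `ν, κ ≥ 0`, Chae's sign `+θ e₂` (the tree's inviscid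
  `IsClassicalBoussinesqOnPlane S u p ρ` of the Kiselev–Park–Yao file is the case `ν = κ = 0` with
  `θ = −ρ`: `IsClassicalBoussinesqOnPlane.diffusive_zero`, PROVED); `….mono` (restriction of the time
  set, PROVED);
* `Boussinesq.HasBoundedSobolevNormsOn S u θ` (the class `⋂ₘ L^∞(S; H^m)` for the pair, the 2-D
  twin of the tree's `HasBoundedSobolevNormsOn`) and `Boussinesq.HasSobolevExtensionPast ν κ u θ T`
  (continuation in the class past `T`, the twin of `HasSobolevExtensionPast`);
* NAMED FACTS (net debt +3, three distinct printed theorems): `chae2006_boussinesq_criterion`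
  (Thm 2.1 = Chae–Nam 1997, in the Beale–Kato–Majda shape of the tree's `beale_kato_majda`),
  `chae2006_boussinesq_zeroDiffusivity_global` (Thm 1.1), `chae2006_boussinesq_zeroViscosity_global`
  (Thm 1.2);
* PROVED readings: `chae2006_boussinesq_zeroDiffusivity_global.hasSobolevExtensionPast` — **at any
  `ν > 0` (and `κ = 0`) NO classical Sobolev-class solution from smooth compactly supported data stops
  at any time `T`** (the global solution of Thm 1.1 is an extension, by the uniqueness clause); the
  `κ > 0`, `ν = 0` twin `chae2006_boussinesq_zeroViscosity_global.hasSobolevExtensionPast`; and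
  `chae2006_boussinesq_criterion.lintegral_eq_top_of_not_hasSobolevExtensionPast` (inviscid blow-up at
  `T` forces `∫₀ᵀ ‖∇θ‖_∞ = ∞`).

## Why the cell wants it (ns-blowup D-0081 §A1; zone Z8 stage 2, zone Z3-b; KPY Thm 1.1 context)

* Zone **Z8-1M** computes the inviscid 2-D Boussinesq corner/mirror collapse (Kiselev–Park–Yao mirror
  class, `BoussinesqSmallScaleFormation.lean`); its STAGE 2 is "the viscous continuation" (START-HERE
  D0081 §Z8: "Z3-b′ verbatim: viscous continuation exists, no fold, `c_l` window ∌ ½ ⇒ KILL"). On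
  `ℝ²` the stage-2 question for the Boussinesq MODEL at any fixed `ν > 0`, `κ = 0` is DECIDED BY
  THEOREM: the solution is global (Thm 1.1), so a viscous finite-time collapse of the model is an
  engine bug and the dynamic-rescaling profile must delocalise or decay — the analogue of RULING (bl)
  for Z6 ("no-swirl `ν`-programme = DECIDED-KILL BY THEOREM + PEN",
  `axisymmetric_no_swirl_global_regularity_holds`). Domain caveat: `ℝ²` here; `𝕋²` and bounded
  no-slip domains are Hu–Kukavica–Ziane 2013 / Lai–Pan–Zhao 2011 (recorded, not typed).
* The inviscid words (Z8-1M stage 1, Z3 sheets) read their clocks `T̂_{∇ρ}` against Thm 2.1: a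
  collapse at `T` in the `H^m` class forces `∫₀ᵀ ‖∇θ‖_∞ dt = ∞` — the Boussinesq twin of the V-G1 /
  BKM consistency print.
* `Summits/…/OSWSelfSimilar/BoussinesqViscousThetaFloor.lean` (Z3-b) defers to exactly this print:
  "For constant `ν > 0` the 2-D Boussinesq system on `ℝ²` is globally regular in print (Hou–Li 2005;
  Chae 2006) — a stronger dynamical statement this file does not touch."

## Rendering notes (read before citing)

* DATA CLASS. Printed: `(v₀, θ₀) ∈ H^m(ℝ²)`, `m > 2` an integer. Typed for the sub-class of smooth
  compactly supported data (`C_c^∞ ⊂ H^m` for every `m`), for which the printed solution lies in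
  `C([0,∞); H^m)` for EVERY `m` and is the "global-in-time smooth solution" of KPY's phrase; it is
  rendered as a jointly smooth classical solution `(u, p, θ)` on `[0, ∞) × ℝ²`
  (`IsClassicalBoussinesqDiffusiveOnPlane (Ici 0)`, pressure made explicit) with finite-energy slices
  and Sobolev norms of all orders bounded on every `[0, T]` (`Boussinesq.HasBoundedSobolevNormsOn`,
  = "`∈ C([0,∞); H^m)` restricted to compacts" for each `m`; joint smoothness in `(t, x)` is the
  standard bootstrap from `C([0,T]; H^m)` for all `m` through the equations — a reading, flagged).
  The `L²(0,T; H^{m+1})` gain of the diffused component and the vanishing-diffusivity /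
  vanishing-viscosity limits are NOT typed.
* UNIQUENESS is typed as: every classical solution on `[0, T)` from the same data whose Sobolev norms
  of all orders are bounded on compact subintervals coincides there with the global one (such a
  solution lies in `C([0,T']; H^m)` for every `m`, the printed uniqueness class).
* Thm 2.1 is typed for `ν = κ = 0` exactly as printed (the partial-viscosity variants are Chae's
  "obvious changes" sentence and are not typed), in the `↔` shape of the tree's `beale_kato_majda`:
  continuation in the class past `T` iff `∫₀ᵀ ‖∇θ‖_∞ < ∞`, with the `L^∞` norm as `⨆ x ‖Dθ(t)(x)‖ₑ`
  and a lower Lebesgue time integral (no junk values).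
* SIGN: Chae's buoyancy is `+θ e₂` (temperature); Kiselev–Park–Yao / Chen–Hou use `−ρ e₂` (density):
  `θ = −ρ` (`IsClassicalBoussinesqOnPlane.diffusive_zero`).

WHAT THIS IS NOT: not Navier–Stokes and not Euler — the 2-D Boussinesq MODEL system; three printed
theorems typed as cited, unasserted `Prop`s plus proved bookkeeping. Nothing here bears on 3-D blow-up.

## Mathlib / tree search

Tree: `IsClassicalBoussinesqOnPlane`, `eY`, `curl2` (KPY / Chen–Hou 2021 files), `IsClassicalNSSolutionOn`
(+ `.mono`), `IsSmoothSpaceTimeOn` (+ `.mono`, `.timeDerivWithin_eq_of_subset`), `convect`,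
`HasFiniteEnergy`, `HasBoundedSobolevNormsOn` / `HasSobolevExtensionPast` / `beale_kato_majda` (3-D
shapes mirrored here); `lean search 'Boussinesq' --decl` = solution-class structures, the WLGSB
self-similar profile and kinetic-theory limits only — no well-posedness / continuation / global
regularity statement for 2-D Boussinesq (`Chae2006|HouLi2005|ChaeNam` = 0 hits). Mathlib:
`uniqueDiffOn_Ico`, `lintegral`, `iSup`.

## References

* D. Chae, Adv. Math. 203 (2006) 497–513, doi:10.1016/j.aim.2005.05.001: Thm 1.1, Thm 1.2 (p. 3),
  Thm 2.1 (p. 3). [`Chae2006Boussinesq`]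
* D. Chae, H.-S. Nam, Proc. Roy. Soc. Edinburgh Sect. A 127 (1997) 935–946 (local existence and the
  `∇θ` blow-up criterion; Chae's ref. [3]); W. E, C.-W. Shu, Phys. Fluids 6 (1994) 49–58 (ref. [6]).
* T. Y. Hou, C. Li, Discrete Contin. Dyn. Syst. 12 (2005) 1–12 (the simultaneous `H^m × H^{m−1}`
  result); M.-J. Lai, R. Pan, K. Zhao, Arch. Ration. Mech. Anal. 199 (2011) 739–760 (bounded domain,
  no-slip); W. Hu, I. Kukavica, M. Ziane, Asymptot. Anal. 85 (2013) (`𝕋²`, bounded, `ℝ²`).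
* A. Kiselev, J. Park, Y. Yao, Anal. PDE (2025) = arXiv:2211.05070, §1.1 (the literature paragraph
  quoted above; Thm 1.1 there presupposes this global smooth solution). [`KiselevParkYao2022`]
-/

noncomputable section

open MeasureTheory Set Function Filter TopologicalSpace
open _root_.Topology
open scoped ContDiff NNReal ENNReal Laplacian

namespace Literature.Analysis.FluidPDE

/-! ### Classical solutions of the 2-D Boussinesq system with viscosity `ν` and diffusivity `κ` -/

/-- **Classical solutions of the 2-D Boussinesq system (B) on `S × ℝ²`** with viscosity `ν ≥ 0` and
thermal diffusivity `κ ≥ 0`, velocity form, Chae's sign convention: `(u, p)` is a jointly smooth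
classical Navier–Stokes solution with viscosity `ν` and body force `+θ e₂`
(`IsClassicalNSSolutionOn S ν (θ e₂) u p`, Euler when `ν = 0`), `θ` is jointly smooth, and
`θₜ + (u·∇)θ = κ Δθ` pointwise on `S × ℝ²`. (B1) is `κ = 0 < ν`, (B2) is `ν = 0 < κ`, the inviscid
system of Kiselev–Park–Yao / Chen–Hou is `ν = κ = 0` with `θ = −ρ`
(`IsClassicalBoussinesqOnPlane.diffusive_zero`).
[cite: Chae2006Boussinesq, §1 system (B), (B1), (B2) (Adv. Math. 203, pp. 2–3)] -/
structure IsClassicalBoussinesqDiffusiveOnPlane (S : Set ℝ) (ν κ : ℝ)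
    (u : ℝ → EuclideanSpace ℝ (Fin 2) → EuclideanSpace ℝ (Fin 2))
    (p θ : ℝ → EuclideanSpace ℝ (Fin 2) → ℝ) : Prop where
  /-- Navier–Stokes (`ν > 0`) / Euler (`ν = 0`) with buoyancy `+θ e₂`, jointly smooth on `S × ℝ²`. -/
  ns : IsClassicalNSSolutionOn S ν (fun t x => (θ t x) • eY) u p
  /-- `θ` is jointly smooth on `S × ℝ²`. -/
  smooth_temperature : IsSmoothSpaceTimeOn S θ
  /-- Transport–diffusion of the temperature: `θₜ + u·∇θ = κ Δθ` on `S × ℝ²`. -/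
  heat : ∀ t ∈ S, ∀ x, timeDerivWithin S θ t x + convect (u t) (θ t) x = κ * (Δ (θ t)) x

/-- Restriction of the time set: a classical solution on `S` is one on every `S' ⊆ S` of unique
differentiability (the one-sided time derivatives agree there). [cite: Chae2006Boussinesq, §1 system (B) (Adv. Math. 203, p. 2)] -/
theorem IsClassicalBoussinesqDiffusiveOnPlane.mono {S S' : Set ℝ} {ν κ : ℝ}
    {u : ℝ → EuclideanSpace ℝ (Fin 2) → EuclideanSpace ℝ (Fin 2)}
    {p θ : ℝ → EuclideanSpace ℝ (Fin 2) → ℝ} (h : IsClassicalBoussinesqDiffusiveOnPlane S ν κ u p θ)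
    (hS' : S' ⊆ S) (hU : UniqueDiffOn ℝ S') : IsClassicalBoussinesqDiffusiveOnPlane S' ν κ u p θ where
  ns := h.ns.mono hS' hU
  smooth_temperature := h.smooth_temperature.mono hS'
  heat t ht x := by
    rw [h.smooth_temperature.timeDerivWithin_eq_of_subset hS' hU ht x]
    exact h.heat t (hS' ht) x

/-- **Dictionary with the inviscid class of the Kiselev–Park–Yao file**: `(u, p, ρ)` is a classical
inviscid Boussinesq solution with buoyancy `−ρ e₂` (`IsClassicalBoussinesqOnPlane S u p ρ`) iff
`(u, p, θ)` with `θ = −ρ` is a classical solution of (B) with `ν = κ = 0`.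
[cite: Chae2006Boussinesq, §1 system (B) with ν = κ = 0 (Adv. Math. 203, p. 2); KiselevParkYao2022 §1 (1.1)] -/
theorem IsClassicalBoussinesqOnPlane.diffusive_zero {S : Set ℝ}
    {u : ℝ → EuclideanSpace ℝ (Fin 2) → EuclideanSpace ℝ (Fin 2)}
    {p ρ : ℝ → EuclideanSpace ℝ (Fin 2) → ℝ} (h : IsClassicalBoussinesqOnPlane S u p ρ) :
    IsClassicalBoussinesqDiffusiveOnPlane S 0 0 u p (fun t x => -ρ t x) where
  ns := by
    have hf : (fun t x => (fun t x => -ρ t x) t x • eY) =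
        (fun t (x : EuclideanSpace ℝ (Fin 2)) => -(ρ t x) • eY) := rfl
    rw [hf]
    exact h.euler
  smooth_temperature := by
    have hneg : uncurry (fun t x => -ρ t x) = fun q => -(uncurry ρ q) := by
      funext q; rfl
    show ContDiffOn ℝ ∞ (uncurry fun t x => -ρ t x) (S ×ˢ univ)
    rw [hneg]
    exact h.smooth_density.neg
  heat t ht x := by
    have h1 := h.transport t ht x
    have hd : timeDerivWithin S (fun t x => -ρ t x) t x = -timeDerivWithin S ρ t x := by
      show derivWithin (fun s => -ρ s x) S t = -derivWithin (fun s => ρ s x) S t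
      exact derivWithin.neg
    have hc : convect (u t) ((fun t x => -ρ t x) t) x = -convect (u t) (ρ t) x := by
      show fderiv ℝ (fun x => -ρ t x) x (u t x) = -(fderiv ℝ (ρ t) x (u t x))
      rw [show (fun x => -ρ t x) = -ρ t from rfl, fderiv_neg]
      rfl
    rw [hd, hc, zero_mul]
    linarith

/-! ### The Sobolev class `⋂ₘ L^∞(S; H^m)` for the pair `(u, θ)` and continuation in it -/

/-- The regularity class of Chae's theorems restricted to a time set `S`: for every `n` the
`L²(ℝ²)` norms of the `n`-th spatial derivatives of `u(t)` and of `θ(t)` are bounded uniformly in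
`t ∈ S` (`(v, θ) ∈ C(S; H^m)` for all `m`, on compact `S`; the 2-D pair twin of the tree's
`HasBoundedSobolevNormsOn`). [cite: Chae2006Boussinesq, Thm 1.1 / Thm 2.1 solution class C([0,T]; H^m(ℝ²)) (Adv. Math. 203, p. 3)] -/
def Boussinesq.HasBoundedSobolevNormsOn (S : Set ℝ)
    (u : ℝ → EuclideanSpace ℝ (Fin 2) → EuclideanSpace ℝ (Fin 2))
    (θ : ℝ → EuclideanSpace ℝ (Fin 2) → ℝ) : Prop :=
  ∀ n : ℕ, ∃ C : ℝ≥0, ∀ t ∈ S,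
    (∫⁻ x, ‖iteratedFDeriv ℝ n (u t) x‖ₑ ^ 2 ≤ C) ∧ (∫⁻ x, ‖iteratedFDeriv ℝ n (θ t) x‖ₑ ^ 2 ≤ C)

/-- The Sobolev class is antitone in the time set. [cite: Chae2006Boussinesq, Thm 2.1 solution class (Adv. Math. 203, p. 3)] -/
theorem Boussinesq.HasBoundedSobolevNormsOn.mono {S S' : Set ℝ}
    {u : ℝ → EuclideanSpace ℝ (Fin 2) → EuclideanSpace ℝ (Fin 2)}
    {θ : ℝ → EuclideanSpace ℝ (Fin 2) → ℝ} (h : Boussinesq.HasBoundedSobolevNormsOn S u θ)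
    (hS' : S' ⊆ S) : Boussinesq.HasBoundedSobolevNormsOn S' u θ :=
  fun n => (h n).imp fun _ hC t ht => hC t (hS' ht)

/-- **Continuation in the class past `T`** (the shape of Thm 2.1's "the solution remains in `H^m`
up to time `T`" and of the tree's `HasSobolevExtensionPast`): there are `T' > T` and a classical
solution `(u', p', θ')` of (B) with the same `ν, κ` on `[0, T') × ℝ²` which agrees with `(u, θ)` on
`[0, T)` and whose Sobolev norms of all orders are bounded on `[0, T]`.
[cite: Chae2006Boussinesq, Thm 2.1 (Adv. Math. 203, p. 3)] -/
def Boussinesq.HasSobolevExtensionPast (ν κ : ℝ)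
    (u : ℝ → EuclideanSpace ℝ (Fin 2) → EuclideanSpace ℝ (Fin 2))
    (θ : ℝ → EuclideanSpace ℝ (Fin 2) → ℝ) (T : ℝ) : Prop :=
  ∃ T' > T, ∃ (u' : ℝ → EuclideanSpace ℝ (Fin 2) → EuclideanSpace ℝ (Fin 2))
    (p' θ' : ℝ → EuclideanSpace ℝ (Fin 2) → ℝ),
    IsClassicalBoussinesqDiffusiveOnPlane (Ico 0 T') ν κ u' p' θ' ∧
      Boussinesq.HasBoundedSobolevNormsOn (Icc 0 T) u' θ' ∧ ∀ t ∈ Ico 0 T, u' t = u t ∧ θ' t = θ t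

/-! ### The named facts -/

/-- **Chae 2006, Theorem 2.1 (= Chae–Nam 1997 / E–Shu 1994): the `∇θ` continuation criterion for
the inviscid 2-D Boussinesq system.** Printed: "Suppose `(v₀, θ₀) ∈ H^m(ℝ²)` with `m > 2` being an
integer. Then, there exists a unique local classical solution `(v, θ) ∈ C([0, T₁); H^m(ℝ²))` …
Moreover, the solution remains in `H^m(ℝ²)` up to time `T > T₁`, namely `(v, θ) ∈ C([0, T]; H^m(ℝ²))`
if and only if `∫₀ᵀ ‖∇θ(t)‖_{L^∞} dt < ∞`." Statement (continuation part, `ν = κ = 0`, in the shape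
of the tree's `beale_kato_majda`): for `T > 0` and a classical inviscid Boussinesq solution
`(u, p, θ)` on `[0, T) × ℝ²` lying in the class `⋂ₘ L^∞([0,T'']; H^m)` on every compact
`[0, T''] ⊆ [0, T)`, the solution continues in the class past `T`
(`Boussinesq.HasSobolevExtensionPast 0 0 u θ T`) **iff** `∫₀ᵀ ‖∇θ(t)‖_{L^∞} dt < ∞`, the `L^∞` norm
being `⨆ x, ‖Dθ(t)(x)‖ₑ` and the time integral a lower Lebesgue integral over `(0, T)`.
[cite: Chae2006Boussinesq, Theorem 2.1 with (2.1) (Adv. Math. 203, p. 3; attributed there to Chae–Nam 1997 and E–Shu 1994)] -/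
def chae2006_boussinesq_criterion : Prop :=
  ∀ (T : ℝ), 0 < T →
    ∀ (u : ℝ → EuclideanSpace ℝ (Fin 2) → EuclideanSpace ℝ (Fin 2))
      (p θ : ℝ → EuclideanSpace ℝ (Fin 2) → ℝ),
      IsClassicalBoussinesqDiffusiveOnPlane (Ico 0 T) 0 0 u p θ →
      (∀ T'' < T, Boussinesq.HasBoundedSobolevNormsOn (Icc 0 T'') u θ) →
      (Boussinesq.HasSobolevExtensionPast 0 0 u θ T ↔
        (∫⁻ t in Ioo 0 T, ⨆ x, ‖fderiv ℝ (θ t) x‖ₑ) < (⊤ : ℝ≥0∞))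

/-- **Chae 2006, Theorem 1.1 (zero diffusivity `κ = 0`, `ν > 0`: global regularity on `ℝ²`).**
Printed: "Let `ν > 0` be fixed, and `div v₀ = 0`. Let `m > 2` be an integer, and
`(v₀, θ₀) ∈ H^m(ℝ²)`. Then, there exists a unique solution `(v, θ)` with `θ ∈ C([0, ∞); H^m(ℝ²))`
and `v ∈ C([0, ∞); H^m(ℝ²)) ∩ L²(0, T; H^{m+1}(ℝ²))` of the system (B1)." **Rendering** (module
docstring): for every `ν > 0` and all smooth compactly supported data `u₀`, `θ₀` with `div u₀ = 0`:
(existence) there is a classical solution `(u, p, θ)` of (B) with `(ν, κ) = (ν, 0)` on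
`[0, ∞) × ℝ²` with `u(0) = u₀`, `θ(0) = θ₀`, finite-energy slices, and Sobolev norms of all orders
bounded on every `[0, T]`; (uniqueness) every classical solution of the same system on some `[0, T)`
from the same data, with Sobolev norms of all orders bounded on compact subintervals, coincides with
it on `[0, T)`. [cite: Chae2006Boussinesq, Theorem 1.1 (Adv. Math. 203, p. 3 L12–L16)] -/
def chae2006_boussinesq_zeroDiffusivity_global : Prop :=
  ∀ (ν : ℝ), 0 < ν →
    ∀ (u₀ : EuclideanSpace ℝ (Fin 2) → EuclideanSpace ℝ (Fin 2)) (θ₀ : EuclideanSpace ℝ (Fin 2) → ℝ),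
      ContDiff ℝ ∞ u₀ → ContDiff ℝ ∞ θ₀ → HasCompactSupport u₀ → HasCompactSupport θ₀ →
      VectorCalculus.IsDivFree u₀ →
      ∃ (u : ℝ → EuclideanSpace ℝ (Fin 2) → EuclideanSpace ℝ (Fin 2))
        (p θ : ℝ → EuclideanSpace ℝ (Fin 2) → ℝ),
        IsClassicalBoussinesqDiffusiveOnPlane (Ici 0) ν 0 u p θ ∧ u 0 = u₀ ∧ θ 0 = θ₀ ∧
        (∀ t : ℝ, 0 ≤ t → HasFiniteEnergy (u t) ∧ HasFiniteEnergy (θ t)) ∧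
        (∀ T : ℝ, 0 ≤ T → Boussinesq.HasBoundedSobolevNormsOn (Icc 0 T) u θ) ∧
        (∀ (T : ℝ) (u' : ℝ → EuclideanSpace ℝ (Fin 2) → EuclideanSpace ℝ (Fin 2))
            (p' θ' : ℝ → EuclideanSpace ℝ (Fin 2) → ℝ),
            IsClassicalBoussinesqDiffusiveOnPlane (Ico 0 T) ν 0 u' p' θ' → u' 0 = u₀ → θ' 0 = θ₀ →
            (∀ T'' < T, Boussinesq.HasBoundedSobolevNormsOn (Icc 0 T'') u' θ') →
            ∀ t ∈ Ico 0 T, u' t = u t ∧ θ' t = θ t)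

/-- **Chae 2006, Theorem 1.2 (zero viscosity `ν = 0`, `κ > 0`: global regularity on `ℝ²`).**
Printed: "Let `κ > 0` be fixed, and `div v₀ = 0`. Let `m > 2` be an integer, and
`(v₀, θ₀) ∈ H^m(ℝ²)`. Then, there exists unique solutions `(v, θ)` with `v ∈ C([0, ∞); H^m(ℝ²))` and
`θ ∈ C([0, ∞); H^m(ℝ²)) ∩ L²(0, T; H^{m+1}(ℝ²))` of the system (B2)." Rendering as for Theorem 1.1
with `(ν, κ) = (0, κ)`. [cite: Chae2006Boussinesq, Theorem 1.2 (Adv. Math. 203, p. 3 L47–L51)] -/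
def chae2006_boussinesq_zeroViscosity_global : Prop :=
  ∀ (κ : ℝ), 0 < κ →
    ∀ (u₀ : EuclideanSpace ℝ (Fin 2) → EuclideanSpace ℝ (Fin 2)) (θ₀ : EuclideanSpace ℝ (Fin 2) → ℝ),
      ContDiff ℝ ∞ u₀ → ContDiff ℝ ∞ θ₀ → HasCompactSupport u₀ → HasCompactSupport θ₀ →
      VectorCalculus.IsDivFree u₀ →
      ∃ (u : ℝ → EuclideanSpace ℝ (Fin 2) → EuclideanSpace ℝ (Fin 2))
        (p θ : ℝ → EuclideanSpace ℝ (Fin 2) → ℝ),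
        IsClassicalBoussinesqDiffusiveOnPlane (Ici 0) 0 κ u p θ ∧ u 0 = u₀ ∧ θ 0 = θ₀ ∧
        (∀ t : ℝ, 0 ≤ t → HasFiniteEnergy (u t) ∧ HasFiniteEnergy (θ t)) ∧
        (∀ T : ℝ, 0 ≤ T → Boussinesq.HasBoundedSobolevNormsOn (Icc 0 T) u θ) ∧
        (∀ (T : ℝ) (u' : ℝ → EuclideanSpace ℝ (Fin 2) → EuclideanSpace ℝ (Fin 2))
            (p' θ' : ℝ → EuclideanSpace ℝ (Fin 2) → ℝ),
            IsClassicalBoussinesqDiffusiveOnPlane (Ico 0 T) 0 κ u' p' θ' → u' 0 = u₀ → θ' 0 = θ₀ →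
            (∀ T'' < T, Boussinesq.HasBoundedSobolevNormsOn (Icc 0 T'') u' θ') →
            ∀ t ∈ Ico 0 T, u' t = u t ∧ θ' t = θ t)

/-! ### Readings (proved) -/

/-- **Blow-up form of Theorem 2.1**: if a classical inviscid Boussinesq solution of the Sobolev class
on `[0, T)`, `T > 0`, does NOT continue in the class past `T`, then `∫₀ᵀ ‖∇θ(t)‖_{L^∞} dt = ∞` —
the Boussinesq twin of the Beale–Kato–Majda necessary condition, i.e. the consistency print for any
computed inviscid collapse clock. [cite: Chae2006Boussinesq, Theorem 2.1 (Adv. Math. 203, p. 3)] -/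
theorem chae2006_boussinesq_criterion.lintegral_eq_top_of_not_hasSobolevExtensionPast
    (h : chae2006_boussinesq_criterion) {T : ℝ} (hT : 0 < T)
    {u : ℝ → EuclideanSpace ℝ (Fin 2) → EuclideanSpace ℝ (Fin 2)}
    {p θ : ℝ → EuclideanSpace ℝ (Fin 2) → ℝ}
    (hsol : IsClassicalBoussinesqDiffusiveOnPlane (Ico 0 T) 0 0 u p θ)
    (hreg : ∀ T'' < T, Boussinesq.HasBoundedSobolevNormsOn (Icc 0 T'') u θ)
    (hmax : ¬ Boussinesq.HasSobolevExtensionPast 0 0 u θ T) :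
    (∫⁻ t in Ioo 0 T, ⨆ x, ‖fderiv ℝ (θ t) x‖ₑ) = (⊤ : ℝ≥0∞) := by
  by_contra hne
  exact hmax ((h T hT u p θ hsol hreg).2 (lt_top_iff_ne_top.2 hne))

/-- **Reading of Theorem 1.1 for the zone: at any `ν > 0` (`κ = 0`) NO classical Sobolev-class
solution from smooth compactly supported data stops at any time.** If `(u', p', θ')` is a classical
solution of (B1) on `[0, T) × ℝ²` from `(u₀, θ₀)` with Sobolev norms of all orders bounded on compact
subintervals, then it continues in the class past `T` (`Boussinesq.HasSobolevExtensionPast ν 0 u' θ' T`):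
the global solution of Theorem 1.1, restricted to `[0, T+1)`, is such an extension by the uniqueness
clause. (Z8 stage 2 on `ℝ²`: a viscous finite-time collapse of the Boussinesq model is excluded by
theorem.) [cite: Chae2006Boussinesq, Theorem 1.1 (Adv. Math. 203, p. 3 L12–L16)] -/
theorem chae2006_boussinesq_zeroDiffusivity_global.hasSobolevExtensionPast
    (h : chae2006_boussinesq_zeroDiffusivity_global) {ν : ℝ} (hν : 0 < ν)
    {u₀ : EuclideanSpace ℝ (Fin 2) → EuclideanSpace ℝ (Fin 2)} {θ₀ : EuclideanSpace ℝ (Fin 2) → ℝ}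
    (hu₀ : ContDiff ℝ ∞ u₀) (hθ₀ : ContDiff ℝ ∞ θ₀) (hcu : HasCompactSupport u₀)
    (hcθ : HasCompactSupport θ₀) (hdiv : VectorCalculus.IsDivFree u₀) {T : ℝ}
    {u' : ℝ → EuclideanSpace ℝ (Fin 2) → EuclideanSpace ℝ (Fin 2)}
    {p' θ' : ℝ → EuclideanSpace ℝ (Fin 2) → ℝ}
    (hsol : IsClassicalBoussinesqDiffusiveOnPlane (Ico 0 T) ν 0 u' p' θ') (hu0 : u' 0 = u₀)
    (hθ0 : θ' 0 = θ₀) (hreg : ∀ T'' < T, Boussinesq.HasBoundedSobolevNormsOn (Icc 0 T'') u' θ') :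
    Boussinesq.HasSobolevExtensionPast ν 0 u' θ' T := by
  obtain ⟨u, p, θ, hglob, -, -, -, hsob, huniq⟩ := h ν hν u₀ θ₀ hu₀ hθ₀ hcu hcθ hdiv
  have hagree := huniq T u' p' θ' hsol hu0 hθ0 hreg
  refine ⟨T + 1, by linarith, u, p, θ, hglob.mono (fun t ht => ht.1) (uniqueDiffOn_Ico 0 (T + 1)),
    ?_, fun t ht => ⟨(hagree t ht).1.symm, (hagree t ht).2.symm⟩⟩
  rcases le_or_gt 0 T with hT | hT
  · exact hsob T hT
  · -- `T < 0`: the interval `[0, T]` is empty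
    intro n
    exact ⟨0, fun t ht => absurd (ht.1.trans ht.2) (not_le.2 hT)⟩

/-- The `κ > 0`, `ν = 0` twin: under Theorem 1.2 every classical Sobolev-class solution of (B2) on
`[0, T) × ℝ²` from smooth compactly supported data continues in the class past `T`.
[cite: Chae2006Boussinesq, Theorem 1.2 (Adv. Math. 203, p. 3 L47–L51)] -/
theorem chae2006_boussinesq_zeroViscosity_global.hasSobolevExtensionPast
    (h : chae2006_boussinesq_zeroViscosity_global) {κ : ℝ} (hκ : 0 < κ)
    {u₀ : EuclideanSpace ℝ (Fin 2) → EuclideanSpace ℝ (Fin 2)} {θ₀ : EuclideanSpace ℝ (Fin 2) → ℝ}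
    (hu₀ : ContDiff ℝ ∞ u₀) (hθ₀ : ContDiff ℝ ∞ θ₀) (hcu : HasCompactSupport u₀)
    (hcθ : HasCompactSupport θ₀) (hdiv : VectorCalculus.IsDivFree u₀) {T : ℝ}
    {u' : ℝ → EuclideanSpace ℝ (Fin 2) → EuclideanSpace ℝ (Fin 2)}
    {p' θ' : ℝ → EuclideanSpace ℝ (Fin 2) → ℝ}
    (hsol : IsClassicalBoussinesqDiffusiveOnPlane (Ico 0 T) 0 κ u' p' θ') (hu0 : u' 0 = u₀)
    (hθ0 : θ' 0 = θ₀) (hreg : ∀ T'' < T, Boussinesq.HasBoundedSobolevNormsOn (Icc 0 T'') u' θ') :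
    Boussinesq.HasSobolevExtensionPast 0 κ u' θ' T := by
  obtain ⟨u, p, θ, hglob, -, -, -, hsob, huniq⟩ := h κ hκ u₀ θ₀ hu₀ hθ₀ hcu hcθ hdiv
  have hagree := huniq T u' p' θ' hsol hu0 hθ0 hreg
  refine ⟨T + 1, by linarith, u, p, θ, hglob.mono (fun t ht => ht.1) (uniqueDiffOn_Ico 0 (T + 1)),
    ?_, fun t ht => ⟨(hagree t ht).1.symm, (hagree t ht).2.symm⟩⟩
  rcases le_or_gt 0 T with hT | hT
  · exact hsob T hT
  · intro n
    exact ⟨0, fun t ht => absurd (ht.1.trans ht.2) (not_le.2 hT)⟩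

/-- **Uniqueness corollary of Theorem 1.1**: two classical Sobolev-class solutions of (B1) on
`[0, T) × ℝ²` from the same smooth compactly supported data coincide on `[0, T)`.
[cite: Chae2006Boussinesq, Theorem 1.1, uniqueness (Adv. Math. 203, p. 3 L12–L16)] -/
theorem chae2006_boussinesq_zeroDiffusivity_global.unique
    (h : chae2006_boussinesq_zeroDiffusivity_global) {ν : ℝ} (hν : 0 < ν)
    {u₀ : EuclideanSpace ℝ (Fin 2) → EuclideanSpace ℝ (Fin 2)} {θ₀ : EuclideanSpace ℝ (Fin 2) → ℝ}
    (hu₀ : ContDiff ℝ ∞ u₀) (hθ₀ : ContDiff ℝ ∞ θ₀) (hcu : HasCompactSupport u₀)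
    (hcθ : HasCompactSupport θ₀) (hdiv : VectorCalculus.IsDivFree u₀) {T : ℝ}
    {u₁ u₂ : ℝ → EuclideanSpace ℝ (Fin 2) → EuclideanSpace ℝ (Fin 2)}
    {p₁ θ₁ p₂ θ₂ : ℝ → EuclideanSpace ℝ (Fin 2) → ℝ}
    (h₁ : IsClassicalBoussinesqDiffusiveOnPlane (Ico 0 T) ν 0 u₁ p₁ θ₁) (hu₁ : u₁ 0 = u₀)
    (hθ₁ : θ₁ 0 = θ₀) (hreg₁ : ∀ T'' < T, Boussinesq.HasBoundedSobolevNormsOn (Icc 0 T'') u₁ θ₁)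
    (h₂ : IsClassicalBoussinesqDiffusiveOnPlane (Ico 0 T) ν 0 u₂ p₂ θ₂) (hu₂ : u₂ 0 = u₀)
    (hθ₂ : θ₂ 0 = θ₀) (hreg₂ : ∀ T'' < T, Boussinesq.HasBoundedSobolevNormsOn (Icc 0 T'') u₂ θ₂) :
    ∀ t ∈ Ico 0 T, u₁ t = u₂ t ∧ θ₁ t = θ₂ t := by
  obtain ⟨u, p, θ, -, -, -, -, -, huniq⟩ := h ν hν u₀ θ₀ hu₀ hθ₀ hcu hcθ hdiv
  intro t ht
  obtain ⟨ha₁, hb₁⟩ := huniq T u₁ p₁ θ₁ h₁ hu₁ hθ₁ hreg₁ t ht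
  obtain ⟨ha₂, hb₂⟩ := huniq T u₂ p₂ θ₂ h₂ hu₂ hθ₂ hreg₂ t ht
  exact ⟨ha₁.trans ha₂.symm, hb₁.trans hb₂.symm⟩

end Literature.Analysis.FluidPDE

end
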